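import Literature.AlgebraicGeometry.Hironaka2017.WQWitness
import Mathlib.RingTheory.MvPolynomial.Basic
import Mathlib.Algebra.MvPolynomial.PDeriv
import Mathlib.Algebra.CharP.Lemmas
import HarnessLib

/-!
# Barrier: after the point blow-up of a tangentially trivial double point `x² + G`, `ord G ≥ 5`, the WHOLE exceptional
# `ℙ^{n−2} ∩ {x̄ = 0}` inherits the initial-form type of the centre — a «stratum-first» recipe keyed to an invariant that does
# not see the exceptional divisor cannot make its top stratum follow the strict transform («StratumFirstInvIncrease»)

`Literature/Barriers/ResolutionOfSingularities/StratumFirstInvIncrease.lean` — barrier catalogue entry (D-0021) for the summit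
`ResolutionOfSingularities`, filed at the request of the LADDER-RESOLUTION cell `res-hironaka` (director-resolution
2026-08-27T00:42:40Z name / 02:30:27Z (1) / 02:47:48Z candidate #3; source: kill-test report `pub/res-hironaka/L/res-L1-k35/KILL-TEST-K3.5.md`
(res-L1-k35; §5 VERDICT / §6 diagnosis; PREREG §4), kit job j265670 (canonical 46fe1cc076050220), kernel chart certificate
`Summits/…/Theorems/MarkedTransferCampaignW35K35ExceptionalTopLocus` p487890 (`fW(x₁y, y, z₁y, w₁y, v₁y) = y²·(x₁² + y⁵H₁)`, partials in
`(y⁴)`); drafter/filer res-type-046). The formal core is PROVED here over an arbitrary commutative ring, for every number of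
variables and every exponent `a`; the W-Q witness of the tree (`WQWitness.fW`) is the kernel specimen.

## The phenomenon (checkable ∀-statement; the specimen is the kernel witness)

Coordinates `x = X 0`, `y_i = X i.succ` on `𝔸^{m+1}`; `𝔪_y = (y_1, …, y_m)` (`StratumFirst.idealY`). Let `f = x² + G` with
`G ∈ 𝔪_y^{a+2}` («tangentially trivial double point, `a := ord_y G − 2`»). In the `y_j`-chart of the blow-up of the origin
(`x ↦ y_j x`, `y_i ↦ y_j y_i` for `i ≠ j`, `y_j ↦ y_j`; `StratumFirst.chart`), kernel facts:

* `chart_j(f) = y_j² · f′` with `f′ = x² + y_j^a · H` (`StratumFirst.chart_doublePoint`; `y_j^N ∣ chart_j(G)` for `G ∈ 𝔪_y^N`,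
  `X_pow_dvd_chart_of_mem_pow`, because `chart_j` maps `𝔪_y` into `(y_j)`);
* (`a ≥ 2`) `f′ ∈ (x, y_j)²` (`transform_mem_sq`): EVERY point of the exceptional section `E_j = {x = y_j = 0} ≅ 𝔸^{m−1}` — the
  chart of `exc ∩ ℙ(x̄ = 0) ≅ ℙ^{m−1}` — is a point of multiplicity `≥ 2` of the transform (and `≤ 2`: the `x²` term); the
  `a = 1` centres (e.g. `x² + y³`-type, the Cossart–Piltant contrast of the kill test) are exactly where this fails;
* (`a ≥ 3`) `f′ − x² ∈ (x, y_j)³` (`transform_sub_sq_mem_cube`; indeed `∈ (y_j)^a`, `transform_sub_sq_mem_pow`): at EVERY point of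
  `E_j` the initial form of the transform is `x̄²` — a tangentially trivial double point of the SAME TYPE as the centre, with
  `a′ ≥ a − 2 ≥ 1` room left;
* (char `2`, `a ≥ 1`) all first partials of `f′` lie in `(y_j^{a−1})` (`pderiv_transform_mem`): tangential triviality of the whole
  exceptional hyperplane (`∂_x x² = 2x = 0`).

Hence (headline `StratumFirstInvIncrease`): for ANY «singularity type» that is a function of the initial form at a point
(multiplicity; the Hilbert–Samuel function and the directrix/ridge of a hypersurface; anything constant on «double point whose
initial form is the square of one linear form»), the top stratum of the transform CONTAINS the whole `(m−1)`-dimensional exceptional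
section as soon as `ord_y G ≥ 5`, although the centre was a point: a recipe «blow up (a regular piece of) the top stratum, then
expect the new top stratum to be the strict transform of the old one» cannot work for such invariants — the top stratum jumps to
dimension `n − 2` inside the exceptional divisor, which the invariant does not see.

**Specimen = the W-Q witness** (`WQStratumFirst.*`): `fW = x² + G_W` on `𝔸⁵` over any commutative ring,
`G_W = wv⁶ + zw⁵v² + yz²wv⁴ + yz³w⁵ + yz⁹ + y⁴zw²v² + y¹¹` (`WQWitness.fW`, `fW_eq`), `G_W ∈ 𝔪_y⁷` (`GW_mem_pow`), so `a = 5` and all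
four bullet points apply in every chart `j ∈ {y, z, w, v}` (`WQ_transform_sameType`, `WQ_pderiv_transform_mem`); the cell's certificate p487890
is the explicit `y`-chart instance `fW1 = x₁² + y⁵H₁`, `∂fW1 ∈ (y⁴)` (Summits side, cited by name, not imported).

## Application recorded here (cell res-hironaka, D-0089; HONEST FRAMING)

H. Hironaka, *Resolution of singularities in positive characteristics*, ms. 2017 [Hironaka2017] is an UNREFEREED MANUSCRIPT UNDER
ADJUDICATION (D-0012); its statements are CANDIDATES, never asserted here. The cell's kill test K3.5 (slot W3.5 «stratum-first regular
cut») found — by HAND STEPS over LIVE FACT-LIST rows (F-21d/e valuative criterion for `℘`, «L-TT») plus exact `𝔽₂` kit arithmetic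
(j265670: 15/15 cells of `P₁ ≅ ℙ³`, 90/90 cells over six steps) — that on the W-Q specimen the manuscript's bare invariant `Inv` of
Eq. (34) p.24 stays MAXIMAL, `Inv = (5,4,2)`, on the whole exceptional `ℙ³ = exc₁ ∩ ℙ(x̄ = 0)` after the first point blow-up and at
every later step of the registered `γ`-tower, while the strict transform of `Σ̄_max` meets `exc₁` in two points — the definition is the
manuscript's [claim: Hironaka2017, status: under-review]; the `Inv` computation is OURS and NOT kernel-checked (scope (b)). The kernel
layer of that finding is exactly this entry's ∀-statement at the specimen (initial form `x̄₁²`, multiplicity `2`, tangential triviality on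
all of `ℙ³`); the step from «same initial-form type» to «same `Inv`» is the hand part (no order-`1` element of `℘(Ê′,1)` at those points:
`d_np ∈ {a, a+1} < 2(a−1) ≤ 2τ_G`, report §6). Verdict of record: K3.5 DEAD-generic for slot W3.5 only, «reduces to R49 (+ G1)»
(director-resolution 2026-08-27T02:30:27Z). Nothing here is a claim about resolution of singularities in characteristic `p`, nor a verdict
on any printed sentence.

## Sources

* The chart substitution of a point blow-up and the behaviour of a double point `x² + (order ≥ 3)` under it are textbook; the same
  coordinates on the same kind of example (`x² + …` in characteristic `2`, monomial-curve top loci) are used in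
  [cite: Kollar2007, Aside 3.57] and in Kollár's «blowing up the worst point can be the wrong blow-up» example catalogued in the
  companion entry `HSBlindToEdgeRank` (nearest relative named by the kill-test seat; not re-read tonight, cited there).
* The specimen and the chart certificate: cell res-hironaka, `WQWitness` (tree) and K3.5 report / p487890 (Summits side).
-/

noncomputable section

namespace Literature.Barriers.ResolutionOfSingularities

open MvPolynomial

universe u

/-! ## 1. The `y_j`-chart of the point blow-up and the controlled transform of `x² + G` -/

namespace StratumFirst

variable (R : Type u) [CommRing R] (m : ℕ)

/-- `𝔪_y = (y_1, …, y_m) ⊂ R[x, y]` (`y_i = X i.succ`, `x = X 0`). [folklore] -/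
def idealY : Ideal (MvPolynomial (Fin (m + 1)) R) :=
  Ideal.span (Set.range fun i : Fin m => (X i.succ : MvPolynomial (Fin (m + 1)) R))

variable {m}

/-- `y_i ∈ 𝔪_y`. [folklore] -/
private theorem X_succ_mem_idealY (i : Fin m) : (X i.succ : MvPolynomial (Fin (m + 1)) R) ∈ idealY R m :=
  Ideal.subset_span ⟨i, rfl⟩

/-- The `y_j`-chart of the blow-up of the origin of `𝔸^{m+1}`: `x ↦ y_j x`, `y_i ↦ y_j y_i` (`i ≠ j`), `y_j ↦ y_j`.
[cite: Kollar2007, Aside 3.57] -/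
def chart (j : Fin m) : MvPolynomial (Fin (m + 1)) R →ₐ[R] MvPolynomial (Fin (m + 1)) R :=
  aeval fun i => if i = j.succ then X j.succ else X j.succ * X i

/-- `chart_j(x) = y_j · x`. [folklore] -/
private theorem chart_X_zero (j : Fin m) : chart R j (X 0) = X j.succ * X 0 := by
  rw [chart, aeval_X, if_neg (Fin.succ_ne_zero j).symm]

/-- `chart_j` maps `𝔪_y` into the principal ideal `(y_j)`. [folklore] -/
private theorem idealY_le_comap (j : Fin m) :
    idealY R m ≤ (Ideal.span {(X j.succ : MvPolynomial (Fin (m + 1)) R)}).comap (chart R j) := by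
  refine Ideal.span_le.2 ?_
  rintro _ ⟨i, rfl⟩
  rw [SetLike.mem_coe, Ideal.mem_comap]
  show aeval _ (X i.succ) ∈ _
  rw [aeval_X]
  split_ifs
  · exact Ideal.mem_span_singleton_self _
  · exact Ideal.mul_mem_right _ _ (Ideal.mem_span_singleton_self _)

/-- If `G ∈ 𝔪_y^N` then `y_j^N` divides `chart_j(G)` (the exceptional divisor `{y_j = 0}` splits off `N` times).
[cite: Kollar2007, Aside 3.57] -/
theorem X_pow_dvd_chart_of_mem_pow (j : Fin m) {N : ℕ} {G : MvPolynomial (Fin (m + 1)) R} (hG : G ∈ idealY R m ^ N) :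
    (X j.succ : MvPolynomial (Fin (m + 1)) R) ^ N ∣ chart R j G := by
  have h1 : G ∈ ((Ideal.span {(X j.succ : MvPolynomial (Fin (m + 1)) R)}).comap (chart R j)) ^ N :=
    Ideal.pow_right_mono (idealY_le_comap R j) N hG
  have h2 := Ideal.le_comap_pow _ N h1
  rw [Ideal.mem_comap, Ideal.span_singleton_pow, Ideal.mem_span_singleton] at h2
  exact h2

/-- **The controlled transform of the double point.** For `f = x² + G`, `G ∈ 𝔪_y^{a+2}`: `chart_j(f) = y_j² · (x² + y_j^a · H)` for
some `H` — the exceptional divisor `{y_j = 0}` splits off with multiplicity exactly the multiplicity `2` of the centre, and the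
transform is again «`x²` plus a multiple of `y_j^a`». [cite: Kollar2007, Aside 3.57] -/
theorem chart_doublePoint (j : Fin m) (G : MvPolynomial (Fin (m + 1)) R) (a : ℕ) (hG : G ∈ idealY R m ^ (a + 2)) :
    ∃ H : MvPolynomial (Fin (m + 1)) R,
      chart R j (X 0 ^ 2 + G) = X j.succ ^ 2 * (X 0 ^ 2 + X j.succ ^ a * H) := by
  obtain ⟨H, hH⟩ := X_pow_dvd_chart_of_mem_pow R j hG
  refine ⟨H, ?_⟩
  rw [map_add, map_pow, chart_X_zero, hH]
  ring

/-! ## 2. The transform `f′ = x² + y_j^a H` along the WHOLE exceptional section `{x = y_j = 0}` -/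

/-- (`a ≥ 2`) `f′ ∈ (x, y_j)²`: every point of the exceptional section `E_j = {x = y_j = 0} ≅ 𝔸^{m−1}` is a point of multiplicity
`≥ 2` of the transform (the maximal ideal of any such point contains `(x, y_j)`). [cite: Kollar2007, Aside 3.57] -/
theorem transform_mem_sq (j : Fin m) (a : ℕ) (ha : 2 ≤ a) (H : MvPolynomial (Fin (m + 1)) R) :
    X 0 ^ 2 + X j.succ ^ a * H ∈ (Ideal.span {(X 0 : MvPolynomial (Fin (m + 1)) R), X j.succ}) ^ 2 := by
  have hx : (X 0 : MvPolynomial (Fin (m + 1)) R) ∈ Ideal.span {(X 0 : MvPolynomial (Fin (m + 1)) R), X j.succ} :=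
    Ideal.subset_span (by simp)
  have hy : (X j.succ : MvPolynomial (Fin (m + 1)) R) ∈ Ideal.span {(X 0 : MvPolynomial (Fin (m + 1)) R), X j.succ} :=
    Ideal.subset_span (by simp)
  exact add_mem (Ideal.pow_mem_pow hx 2) (Ideal.mul_mem_right _ _ (Ideal.pow_le_pow_right ha (Ideal.pow_mem_pow hy a)))

/-- `f′ − x² ∈ (y_j)^a`: along the exceptional section the transform agrees with `x²` up to a multiple of `y_j^a`.
[cite: Kollar2007, Aside 3.57] -/
theorem transform_sub_sq_mem_pow (j : Fin m) (a : ℕ) (H : MvPolynomial (Fin (m + 1)) R) :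
    (X 0 ^ 2 + X j.succ ^ a * H) - X 0 ^ 2 ∈ (Ideal.span {(X j.succ : MvPolynomial (Fin (m + 1)) R)}) ^ a := by
  rw [add_sub_cancel_left]
  exact Ideal.mul_mem_right _ _ (Ideal.pow_mem_pow (Ideal.mem_span_singleton_self _) a)

/-- (`a ≥ 3`) `f′ − x² ∈ (x, y_j)³`: at EVERY point of the exceptional section the initial form of the transform is `x̄²` — a
tangentially trivial double point of the same type as the centre. [cite: Kollar2007, Aside 3.57] -/
theorem transform_sub_sq_mem_cube (j : Fin m) (a : ℕ) (ha : 3 ≤ a) (H : MvPolynomial (Fin (m + 1)) R) :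
    (X 0 ^ 2 + X j.succ ^ a * H) - X 0 ^ 2 ∈ (Ideal.span {(X 0 : MvPolynomial (Fin (m + 1)) R), X j.succ}) ^ 3 := by
  refine Ideal.pow_le_pow_right ha (Ideal.pow_right_mono (Ideal.span_mono (by simp)) a (transform_sub_sq_mem_pow R j a H))

/-- (char `2`, `a ≥ 1`) every first partial of `f′ = x² + y_j^a H` lies in `(y_j^{a−1})`: the whole exceptional hyperplane is
tangentially trivial (`∂ x² = 2x·∂x = 0`). [cite: Kollar2007, Aside 3.57] -/
theorem pderiv_transform_mem [CharP R 2] (j : Fin m) (a : ℕ) (H : MvPolynomial (Fin (m + 1)) R) (i : Fin (m + 1)) :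
    pderiv i (X 0 ^ 2 + X j.succ ^ a * H) ∈ Ideal.span {(X j.succ : MvPolynomial (Fin (m + 1)) R) ^ (a - 1)} := by
  have h2 : pderiv i ((X 0 : MvPolynomial (Fin (m + 1)) R) ^ 2) = 0 := by
    rw [(pderiv i).leibniz_pow, nsmul_eq_mul, show ((2 : ℕ) : MvPolynomial (Fin (m + 1)) R) = 0 from
      CharP.cast_eq_zero (MvPolynomial (Fin (m + 1)) R) 2, zero_mul]
  have hXa : (X j.succ : MvPolynomial (Fin (m + 1)) R) ^ a ∈ Ideal.span {(X j.succ : MvPolynomial (Fin (m + 1)) R) ^ (a - 1)} :=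
    Ideal.mem_span_singleton.mpr (pow_dvd_pow _ (Nat.sub_le a 1))
  rw [map_add, h2, zero_add, (pderiv i).leibniz, (pderiv i).leibniz_pow]
  simp only [smul_eq_mul, nsmul_eq_mul]
  exact add_mem (Ideal.mul_mem_right _ _ hXa)
    (Ideal.mul_mem_left _ _ (Ideal.mul_mem_left _ _ (Ideal.mul_mem_right _ _ (Ideal.mem_span_singleton_self _))))

/-- **All four facts at once for `f = x² + G`, `G ∈ 𝔪_y^{a+2}`, `a ≥ 3`** (characteristic-free part): in every chart `j` the transform
`f′` (with `chart_j f = y_j² f′`) is a double point of the same initial-form type `x̄²` at EVERY point of the exceptional section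
`{x = y_j = 0}`. [cite: Kollar2007, Aside 3.57] -/
theorem transform_sameType (j : Fin m) (G : MvPolynomial (Fin (m + 1)) R) (a : ℕ) (ha : 3 ≤ a)
    (hG : G ∈ idealY R m ^ (a + 2)) :
    ∃ f' H : MvPolynomial (Fin (m + 1)) R, chart R j (X 0 ^ 2 + G) = X j.succ ^ 2 * f' ∧ f' = X 0 ^ 2 + X j.succ ^ a * H ∧
      f' ∈ (Ideal.span {(X 0 : MvPolynomial (Fin (m + 1)) R), X j.succ}) ^ 2 ∧
      f' - X 0 ^ 2 ∈ (Ideal.span {(X 0 : MvPolynomial (Fin (m + 1)) R), X j.succ}) ^ 3 := by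
  obtain ⟨H, hH⟩ := chart_doublePoint R j G a hG
  exact ⟨_, H, hH, rfl, transform_mem_sq R j a (by omega) H, transform_sub_sq_mem_cube R j a ha H⟩

end StratumFirst

/-! ## 2. Specimen: the W-Q witness `fW = x² + G_W ⊂ 𝔸⁵`, `G_W ∈ 𝔪_y⁷` (`a = 5`) -/

namespace WQStratumFirst

open Literature.AlgebraicGeometry.Hironaka2017.WQWitness (fW)

variable (R : Type u) [CommRing R]

/-- `G_W = wv⁶ + zw⁵v² + yz²wv⁴ + yz³w⁵ + yz⁹ + y⁴zw²v² + y¹¹` (coordinates `x,y,z,w,v = X 0,…,X 4`). [folklore] -/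
def GW : MvPolynomial (Fin 5) R :=
  X 3 * X 4 ^ 6 + X 2 * X 3 ^ 5 * X 4 ^ 2 + X 1 * X 2 ^ 2 * X 3 * X 4 ^ 4 + X 1 * X 2 ^ 3 * X 3 ^ 5
    + X 1 * X 2 ^ 9 + X 1 ^ 4 * X 2 * X 3 ^ 2 * X 4 ^ 2 + X 1 ^ 11

/-- `fW = x² + G_W` (the tree's W-Q witness `WQWitness.fW`). [claim: Hironaka2017, status: under-review]
STATUS: kernel fact about the cell's OWN specimen (prior record C18, tree `WQWitness`); nothing of the manuscript is asserted (D-0012/D-0089). -/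
theorem fW_eq : (fW : MvPolynomial (Fin 5) R) = X 0 ^ 2 + GW R := by
  rw [fW, GW]; ring

/-- `G_W ∈ 𝔪_y⁷`: every monomial of `G_W` has degree `≥ 7` in `(y, z, w, v)` — `fW` is a tangentially trivial double point with
`a = 5`. [claim: Hironaka2017, status: under-review]
STATUS: kernel fact about the cell's OWN specimen; nothing of the manuscript is asserted (D-0012/D-0089). -/
theorem GW_mem_pow : GW R ∈ StratumFirst.idealY R 4 ^ 7 := by
  have key : ∀ {a b : ℕ} {u v : MvPolynomial (Fin 5) R}, u ∈ StratumFirst.idealY R 4 ^ a →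
      v ∈ StratumFirst.idealY R 4 ^ b → u * v ∈ StratumFirst.idealY R 4 ^ (a + b) :=
    fun hu hv => pow_add (StratumFirst.idealY R 4) _ _ ▸ Ideal.mul_mem_mul hu hv
  have h : ∀ (i : Fin 4) (n : ℕ), (X i.succ : MvPolynomial (Fin 5) R) ^ n ∈ StratumFirst.idealY R 4 ^ n :=
    fun i n => Ideal.pow_mem_pow (StratumFirst.X_succ_mem_idealY R i) n
  have h1 : ∀ i : Fin 4, (X i.succ : MvPolynomial (Fin 5) R) ∈ StratumFirst.idealY R 4 ^ 1 := fun i => by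
    simpa using h i 1
  have le : ∀ {n : ℕ} (_ : 7 ≤ n) {u : MvPolynomial (Fin 5) R}, u ∈ StratumFirst.idealY R 4 ^ n →
      u ∈ StratumFirst.idealY R 4 ^ 7 := fun {n} hn {u} hu => Ideal.pow_le_pow_right hn hu
  unfold GW
  refine add_mem (add_mem (add_mem (add_mem (add_mem (add_mem ?_ ?_) ?_) ?_) ?_) ?_) ?_
  · exact le (by norm_num) (key (h1 2) (h 3 6))
  · exact le (by norm_num) (key (key (h1 1) (h 2 5)) (h 3 2))
  · exact le (by norm_num) (key (key (key (h1 0) (h 1 2)) (h1 2)) (h 3 4))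
  · exact le (by norm_num) (key (key (h1 0) (h 1 3)) (h 2 5))
  · exact le (by norm_num) (key (h1 0) (h 1 9))
  · exact le (by norm_num) (key (key (key (h 0 4) (h1 1)) (h 2 2)) (h 3 2))
  · exact le (by norm_num) (h 0 11)

/-- **The specimen instance**: in every chart `j ∈ {y, z, w, v}` of the blow-up of `𝔸⁵` at the origin, the transform of the W-Q
witness is `y_j² · f′` with `f′ = x² + y_j⁵ H`, `f′ ∈ (x, y_j)²` and `f′ − x² ∈ (x, y_j)³`: EVERY point of the exceptional section
`{x = y_j = 0} ≅ 𝔸³` (chart of `exc ∩ ℙ(x̄ = 0) ≅ ℙ³`) is a double point with initial form `x̄²`, the type of the centre.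
[claim: Hironaka2017, status: under-review]
STATUS: kernel fact about the cell's OWN specimen (the kernel layer of kill test K3.5; cf. p487890 for the explicit `y`-chart); nothing of the manuscript is asserted (D-0012/D-0089). -/
theorem WQ_transform_sameType (j : Fin 4) :
    ∃ f' H : MvPolynomial (Fin 5) R, StratumFirst.chart R j fW = X j.succ ^ 2 * f' ∧ f' = X 0 ^ 2 + X j.succ ^ 5 * H ∧
      f' ∈ (Ideal.span {(X 0 : MvPolynomial (Fin 5) R), X j.succ}) ^ 2 ∧
      f' - X 0 ^ 2 ∈ (Ideal.span {(X 0 : MvPolynomial (Fin 5) R), X j.succ}) ^ 3 := by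
  rw [fW_eq]
  exact StratumFirst.transform_sameType R j (GW R) 5 (by norm_num) (GW_mem_pow R)

/-- In characteristic `2` the specimen's transforms are tangentially trivial along the whole exceptional hyperplane:
`∂f′ ⊂ (y_j⁴)` in every chart (cf. p487890: `∂fW1 ∈ (y⁴)` in the `y`-chart). [claim: Hironaka2017, status: under-review]
STATUS: kernel fact about the cell's OWN specimen; nothing of the manuscript is asserted (D-0012/D-0089). -/
theorem WQ_pderiv_transform_mem [CharP R 2] (j : Fin 4) :
    ∃ f' : MvPolynomial (Fin 5) R, StratumFirst.chart R j fW = X j.succ ^ 2 * f' ∧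
      ∀ i, pderiv i f' ∈ Ideal.span {(X j.succ : MvPolynomial (Fin 5) R) ^ 4} := by
  obtain ⟨H, hH⟩ := StratumFirst.chart_doublePoint R j (GW R) 5 (GW_mem_pow R)
  refine ⟨_, by rw [fW_eq]; exact hH, fun i => ?_⟩
  simpa using StratumFirst.pderiv_transform_mem R j 5 H i

end WQStratumFirst

/-! ## 3. The barrier statement -/

/-- **Barrier («StratumFirstInvIncrease»), proved.** For every commutative ring `R`, every `m`, every `G ∈ 𝔪_y^{a+2} ⊂ R[x, y_1..y_m]`
with `a ≥ 3` (a tangentially trivial double point `f = x² + G` with `ord_y G ≥ 5`) and every chart `j` of the point blow-up: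
`chart_j(f) = y_j² · f′`, `f′ = x² + y_j^a H`, with `f′ ∈ (x, y_j)²` and `f′ − x² ∈ (x, y_j)³` — EVERY point of the exceptional section
`{x = y_j = 0} ≅ 𝔸^{m−1}` (covering `exc ∩ ℙ(x̄ = 0) ≅ ℙ^{m−1}` as `j` varies) is a double point of the transform with initial form `x̄²`,
the SAME initial-form type as the centre (and, in characteristic `2`, tangentially trivial: `∂f′ ⊂ (y_j^{a−1})`,
`StratumFirst.pderiv_transform_mem`). Consequently the top stratum of ANY invariant that is a function of the initial-form type
(multiplicity, Hilbert–Samuel function / directrix of a hypersurface, …) contains the whole `(m−1)`-dimensional exceptional section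
after blowing up the point: it does NOT follow the strict transform of the old top stratum. Specimen (kernel witness): the W-Q
hypersurface `fW = x² + G_W ⊂ 𝔸⁵`, `G_W ∈ 𝔪_y⁷` (`WQStratumFirst.WQ_transform_sameType`, every chart; `WQ_pderiv_transform_mem`).
[cite: Kollar2007, Aside 3.57]

Technique class, in prose: «stratum-first» resolution recipes — stratify `Sing` by an intrinsic upper-semicontinuous invariant
computed from the local singularity type WITHOUT exceptional-divisor / boundary data, blow up the top stratum `Σ̄_max` (pointwise
where it is not regular), and expect the new top stratum to be (inside) the strict transform of the old one, so that «resolve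
`Σ̄_max` first, then use it as a regular cut / centre» terminates.

BARRIER (D-0021):
- technique_class: stratum-first top-locus-first bare-invariant no-boundary-datum intrinsic-stratification initial-form-type multiplicity-stratum hilbert-samuel-stratum point-blowup-spreading exceptional-divisor positive-characteristic
- blocks: (1) every recipe of the class above whose invariant is a function of the initial-form type at the point, on ANY tangentially trivial double point `x² + G`, `ord_y G ≥ 5`, in ANY characteristic and dimension `m + 1 ≥ 2`: after the point blow-up the top stratum contains `exc ∩ ℙ(x̄ = 0) ≅ ℙ^{m−1}` (`StratumFirst.transform_sameType`, all charts), so its dimension jumps from `≤ dim Σ̄_max(centre)` to `m − 1 = n − 2` and its closure is not the strict transform; iterating along a curve of such points (the transform has `a′ ≥ a − 2`, and on the specimen `a` GROWS: `5, 7, 14, 21, 28, 35` along `γ`, kill test K3.5) the spreading never stops; (2) in particular slot W3.5 «stratum-first regular cut» of the cell res-hironaka with the 2017 manuscript's bare `Inv` of Eq. (34) p.24 — kill test K3.5 (res-L1-k35; report `KILL-TEST-K3.5.md` §5, kit j265670 46fe1cc076050220, kernel chart certificate p487890): `Inv = (5,4,2) = Inv_max` on all of `P₁ ≅ ℙ³`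 and on `P_k ≅ ℙ³` at every step `k ≤ 6` of the `γ`-tower, while `Γ′ ∩ exc₁` is two points; `Σ̄_max(Ê^{(k)}) ⊇ P_k ∪ γ^{(k)}` never regular at `q_k` — verdict DEAD-generic, «reduces to R49 (+ G1)» [claim: Hironaka2017, status: under-review] (Eq. (34) defines `Inv`; the computation of `Inv` on `ℙ³` is the cell's HAND + kit work, scope (b)); (3) the same for the `(HS, e)` stratifier of the cell's W3.2 variant (V-c) at the exceptional points (hypersurface: `HS` and the directrix are functions of the initial form `x̄₁²`).
- because: `chart_j` maps `𝔪_y` into `(y_j)` (`idealY_le_comap`), so `G ∈ 𝔪_y^{a+2}` gives `y_j^{a+2} ∣ chart_j(G)` (`X_pow_dvd_chart_of_mem_pow`, via `Ideal.le_comap_pow`) and `chart_j(x² + G) = y_j²(x² + y_j^a H)` (`chart_doublePoint`); then `x² + y_j^a H ∈ (x, y_j)²` for `a ≥ 2` and `≡ x²` modulo `(y_j)^a ⊆ (x, y_j)³` for `a ≥ 3` (`transform_mem_sq`, `transform_sub_sq_mem_pow`, `transform_sub_sq_mem_cube`); in characteristic `2`, `∂(x²) = 0` and `∂(y_j^a H)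 ∈ (y_j^{a−1})` (`pderiv_transform_mem`). The exceptional divisor enters `f′` only through the factor `y_j^a`, invisible to the initial form at points of `{y_j = 0}` when `a ≥ 3`.
- evasions_known: (i) a BOUNDARY-AWARE invariant `ι = (Inv, β)` whose second letter sees the exceptional divisor (age / exceptional multiplicity after a canonical cleaning; the CJS datum `(HS, e, boundary)`; in the manuscript's own terms the résumé SEQUENCE of Th. 16.6 (2) Eq. (127), whose later entries need the `℘nega`/LL-chain machinery — cell rows R49 + G1) — K3.5 §6 «WHAT a surviving line would need» [claim: Hironaka2017, status: under-review]; (ii) order-`3` tails, `a = 1` (`x² + G`, `ord G = 3`, e.g. the Cossart–Piltant 2019 Rem. 3.2-type centres used as contrast in the kill test): then `f′ = x² + y_j H` and the exceptional points with `H ≠ 0` are REGULAR — no spreading (`transform_mem_sq` needs `a ≥ 2`); (iii) do not blow up points of the top stratum at all (centres of positive dimension chosen by other data) — the kill test's VARIATION found a 2-dimensional `Inv_max` surface over `0` even then on the specimen (evidence in the report, not formalised here); (iv) invariants that are NOT functions of the initial-form type (e.g. weighted / quasi-homogeneous initial parts, characteristic polyhedra) are outside blocks (1) by construction — whether they spread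 on the specimen is not addressed here.
- scope_caveats: (a) PROVED: the chart/ideal-membership statements for all `R`, `m`, `a`, `j`, and the specimen memberships (`G_W ∈ 𝔪_y⁷`, all four charts); «multiplicity `≥ 2` at every point of `{x = y_j = 0}`» and «initial form `x̄²`» are recorded as the ideal memberships `f′ ∈ (x,y_j)²`, `f′ − x² ∈ (x,y_j)³` (the maximal ideal of every `R`-point of that section contains `(x, y_j)`; the translation to points and the glueing of the charts into `ℙ^{m−1}` are not spelled out); (b) NOT kernel-checked: that the manuscript's `Inv` (or `(HS, e)`, or the absence of an order-`1` element of `℘(Ê′,1)`) takes the SAME value at the exceptional points as at the centre — this is K3.5's hand criterion (L-TT: `d_np < 2τ_G`) + kit cells; the entry covers exactly the invariants that are functions of the initial-form type, for which (b) is automatic; (c) the hypothesis is `G ∈ 𝔪_y^{a+2}` in `R[x, y]` (monomials of `y`-degree `≥ a+2`; `G` may involve `x`); nothing is claimed for `ord_y G ≤ 4` beyond `transform_mem_sq` (`a = 2`); (d) nothing here bears on the EXISTENCE of resolutions in characteristic `p`, nor on boundary-aware invariants (evasion (i)), nor on what the correct centre is.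
- status: established (kernel-checked: general chart statements; specimen W-Q, `a = 5`, every chart; characteristic-`2` tangential triviality)
-/
theorem StratumFirstInvIncrease :
    (∀ (R : Type u) [CommRing R] (m : ℕ) (j : Fin m) (G : MvPolynomial (Fin (m + 1)) R) (a : ℕ), 3 ≤ a →
        G ∈ StratumFirst.idealY R m ^ (a + 2) →
        ∃ f' H : MvPolynomial (Fin (m + 1)) R, StratumFirst.chart R j (X 0 ^ 2 + G) = X j.succ ^ 2 * f' ∧
          f' = X 0 ^ 2 + X j.succ ^ a * H ∧
          f' ∈ (Ideal.span {(X 0 : MvPolynomial (Fin (m + 1)) R), X j.succ}) ^ 2 ∧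
          f' - X 0 ^ 2 ∈ (Ideal.span {(X 0 : MvPolynomial (Fin (m + 1)) R), X j.succ}) ^ 3) ∧
    (∀ (R : Type u) [CommRing R] (j : Fin 4),
        ∃ f' H : MvPolynomial (Fin 5) R,
          StratumFirst.chart R j Literature.AlgebraicGeometry.Hironaka2017.WQWitness.fW = X j.succ ^ 2 * f' ∧
          f' = X 0 ^ 2 + X j.succ ^ 5 * H ∧
          f' ∈ (Ideal.span {(X 0 : MvPolynomial (Fin 5) R), X j.succ}) ^ 2 ∧
          f' - X 0 ^ 2 ∈ (Ideal.span {(X 0 : MvPolynomial (Fin 5) R), X j.succ}) ^ 3) :=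
  ⟨fun R _ _ j G a ha hG => StratumFirst.transform_sameType R j G a ha hG,
    fun R _ j => WQStratumFirst.WQ_transform_sameType R j⟩

end Literature.Barriers.ResolutionOfSingularities

end
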